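/- Width seat `ym-line-sfw-p2-w5` (prover-ym-line-sfw-p2-w5-g18-0), free hands on planner ym-idea-2 g16's LINE-19 task board, task T3
(crux `AllWindowsColdBox.BoxHighWindowsSU22` = stmt-QuantumFields-24004 / low item 24335, stub S4b one-step bootstrap §10):
the quaternion BCH estimate `QuaternionBCH` of the bootstrap kit, PROVED (constant `C₁ = 588`). -/
import Summits.QuantumFields.YangMills.Theorems.AllWindowsColdBoxBoxHighLineImVecSqLeCost

/-!
# LINE-19 S4b bootstrap, T3: quaternion BCH to second order — `QuaternionBCH` proved with `C₁ = 588`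

Statement (typed in ✓`…BoxHighLineHodgeBootstrap`, planner ym-idea-2 g16, STUB-PLAN-S4b §10 T3): for four `SU(2)` links `W₀,…,W₃` in the
hemisphere `Re (W_k)₀₀ ≥ 1/2` whose su(2)-coordinates `imVec W_k` are all `≤ M` in absolute value, every su(2)-coordinate of the plaquette product
`W₀W₁W₂⁻¹W₃⁻¹` differs from the signed sum `imVec W₀ + imVec W₁ − imVec W₂ − imVec W₃` by at most `C₁·M·Σ_k Σ_c |imVec W_k c|`.

Proof (no `Matrix.exp`, no BCH series): scalar/vector split in `M₂(ℂ)` with the ℓ∞-operator norm (`Matrix.Norms.Operator`: submultiplicative,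
`‖1‖ = 1`, entries bounded by the norm).  With `X₀ = W₀`, `X₁ = W₁`, `X₂ = W₂ᴴ`, `X₃ = W₃ᴴ` and `Y_k = X_k − 1`, the exact ring identity
`X₀X₁X₂X₃ − 1 − Σ_k Y_k = (Y₀Y₁X₂ + Y₀Y₂ + Y₁Y₂)·X₃ + (Y₀ + Y₁ + Y₂)·Y₃` (`prod_four_sub_one_sub_sum_eq`) isolates the second-order remainder;
the su(2)-coordinates are ℝ-linear in the matrix (`imVecM`, `imVecM_add/sub/one`), read `imVec W` on `W` and `−imVec W` on `Wᴴ` (`imVecM_star_coe`),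
and are bounded by the norm (`abs_imVecM_le_norm`); finally `‖W − 1‖, ‖Wᴴ − 1‖ ≤ (1 − Re W₀₀) + Σ_c|imVec W c| ≤ 2·Σ_c|imVec W c|` on the hemisphere
`Re W₀₀ ≥ 0` (`norm_coe_sub_one_le`, `norm_star_coe_sub_one_le`; `1 − s ≤ 1 − s² = |imVec|²` and `|imVec c| ≤ 1`), so every product `‖Y_j‖‖Y_k‖` is
`≤ 12·M·Σ_c|imVec W_k c|` and the remainder is `≤ 588·M·Σ_kΣ_c|imVec W_k c|`.  The hypothesis `Re ≥ 1/2` of the typed statement is used only as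
`Re ≥ 0`.

Result: **`quaternionBCH : QuaternionBCH`**.  One definition (`imVecM`, the linear extension of `imVec` to `M₂(ℂ)`); everything else proved;
standard axioms.  HONEST LABEL: task T3 of the S4b bootstrap = a helper toward ONE registered stub of a critic-PASSed line on the R2ξ″ RECORD-rung
crux 24004 / 24335; no stub is proved by name, no crux, rung or summit is proved; the Yang–Mills mass gap is NOT proved by this file.
-/

set_option autoImplicit false

noncomputable section

open Matrix
open scoped Matrix.Norms.Operator

namespace Summit.QuantumFields.YangMills.Theorems.AllWindowsColdBoxBoxHighLine

/-! ## The su(2)-coordinates as an ℝ-linear functional on `M₂(ℂ)` -/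

/-- The su(2)-coordinate functional on all of `M₂(ℂ)`: `(Im X₀₀, Re X₁₀, Im X₁₀)` (so that `imVec W = imVecM ↑W`). -/
def imVecM (X : Matrix (Fin 2) (Fin 2) ℂ) : Fin 3 → ℝ := ![(X 0 0).im, (X 1 0).re, (X 1 0).im]

/-- `imVec` is `imVecM` of the underlying matrix. -/
theorem imVec_eq_imVecM (W : SU2) : imVec W = imVecM (W : Matrix (Fin 2) (Fin 2) ℂ) := rfl

/-- Additivity. -/
theorem imVecM_add (X Y : Matrix (Fin 2) (Fin 2) ℂ) : imVecM (X + Y) = imVecM X + imVecM Y := by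
  ext c
  fin_cases c <;> simp [imVecM]

/-- Subtractivity. -/
theorem imVecM_sub (X Y : Matrix (Fin 2) (Fin 2) ℂ) : imVecM (X - Y) = imVecM X - imVecM Y := by
  ext c
  fin_cases c <;> simp [imVecM]

/-- The identity has no vector part. -/
theorem imVecM_one : imVecM (1 : Matrix (Fin 2) (Fin 2) ℂ) = 0 := by
  ext c
  fin_cases c <;> simp [imVecM]

/-- The adjoint (= inverse) of an `SU(2)` matrix has the opposite vector part. -/
theorem imVecM_star_coe (W : SU2) : imVecM (star (W : Matrix (Fin 2) (Fin 2) ℂ)) = -imVec W := by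
  have h01 := apply_zero_one_eq_neg_conj W
  ext c
  fin_cases c
  · simp [imVecM, imVec, Matrix.star_apply, Complex.conj_im]
  · simp [imVecM, imVec, Matrix.star_apply, h01]
  · simp [imVecM, imVec, Matrix.star_apply, h01, Complex.conj_im]

/-- Every entry is bounded by the ℓ∞-operator norm. -/
theorem norm_entry_le_linfty_opNorm (X : Matrix (Fin 2) (Fin 2) ℂ) (i j : Fin 2) : ‖X i j‖ ≤ ‖X‖ := by
  rw [Matrix.linfty_opNorm_def]
  have h1 : ‖X i j‖₊ ≤ ∑ j' : Fin 2, ‖X i j'‖₊ :=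
    Finset.single_le_sum (f := fun j' => ‖X i j'‖₊) (fun _ _ => bot_le) (Finset.mem_univ j)
  have h2 : (∑ j' : Fin 2, ‖X i j'‖₊) ≤ (Finset.univ : Finset (Fin 2)).sup fun i' => ∑ j' : Fin 2, ‖X i' j'‖₊ :=
    Finset.le_sup (f := fun i' : Fin 2 => ∑ j' : Fin 2, ‖X i' j'‖₊) (Finset.mem_univ i)
  exact_mod_cast h1.trans h2

/-- The su(2)-coordinates are bounded by the norm: `|imVecM X c| ≤ ‖X‖`. -/
theorem abs_imVecM_le_norm (X : Matrix (Fin 2) (Fin 2) ℂ) (c : Fin 3) : |imVecM X c| ≤ ‖X‖ := by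
  fin_cases c
  · exact (Complex.abs_im_le_norm (X 0 0)).trans (norm_entry_le_linfty_opNorm X 0 0)
  · exact (Complex.abs_re_le_norm (X 1 0)).trans (norm_entry_le_linfty_opNorm X 1 0)
  · exact (Complex.abs_im_le_norm (X 1 0)).trans (norm_entry_le_linfty_opNorm X 1 0)

/-! ## Norm bounds for one link -/

/-- Row-sum criterion for the ℓ∞-operator norm on `M₂(ℂ)`. -/
theorem linfty_opNorm_le_of_rows {X : Matrix (Fin 2) (Fin 2) ℂ} {B : ℝ} (hB : 0 ≤ B)
    (h : ∀ i : Fin 2, ‖X i 0‖ + ‖X i 1‖ ≤ B) : ‖X‖ ≤ B := by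
  rw [Matrix.linfty_opNorm_def]
  have hsup : ((Finset.univ : Finset (Fin 2)).sup fun i => ∑ j : Fin 2, ‖X i j‖₊) ≤ ⟨B, hB⟩ := by
    refine Finset.sup_le fun i _ => ?_
    rw [← NNReal.coe_le_coe, NNReal.coe_sum, Fin.sum_univ_two, coe_nnnorm, coe_nnnorm]
    exact h i
  exact_mod_cast hsup

/-- `1 − Re W₀₀ ≤ Σ_c |imVec W c|` on the hemisphere `Re W₀₀ ≥ 0` (`1 − s ≤ 1 − s² = Σ_c v_c² ≤ Σ_c |v_c|`). -/
theorem one_sub_re_le_sum_abs_imVec (W : SU2) (hs : 0 ≤ ((W : Matrix (Fin 2) (Fin 2) ℂ) 0 0).re) :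
    1 - ((W : Matrix (Fin 2) (Fin 2) ℂ) 0 0).re ≤ ∑ c : Fin 3, |imVec W c| := by
  have h := re_sq_add_sum_imVec_sq W
  have h1 : ((W : Matrix (Fin 2) (Fin 2) ℂ) 0 0).re ≤ 1 := (abs_le.mp (abs_re_apply_zero_zero_le_one W)).2
  have hsq : ∀ c : Fin 3, imVec W c ^ 2 ≤ |imVec W c| := fun c => by
    have ha := abs_imVec_le_one W c
    rw [← sq_abs]
    nlinarith [abs_nonneg (imVec W c)]
  calc 1 - ((W : Matrix (Fin 2) (Fin 2) ℂ) 0 0).re ≤ 1 - ((W : Matrix (Fin 2) (Fin 2) ℂ) 0 0).re ^ 2 := by nlinarith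
    _ = ∑ c : Fin 3, imVec W c ^ 2 := by linarith
    _ ≤ ∑ c : Fin 3, |imVec W c| := Finset.sum_le_sum fun c _ => hsq c

/-- **`‖W − 1‖ ≤ 2·Σ_c |imVec W c|`** on the hemisphere `Re W₀₀ ≥ 0`. -/
theorem norm_coe_sub_one_le (W : SU2) (hs : 0 ≤ ((W : Matrix (Fin 2) (Fin 2) ℂ) 0 0).re) :
    ‖(W : Matrix (Fin 2) (Fin 2) ℂ) - 1‖ ≤ 2 * ∑ c : Fin 3, |imVec W c| := by
  have h11 := Literature.MathematicalPhysics.QuantumLattice.su2_apply_11 W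
  have h01 := apply_zero_one_eq_neg_conj W
  have hd := one_sub_re_le_sum_abs_imVec W hs
  have hn : 0 ≤ ∑ c : Fin 3, |imVec W c| := Finset.sum_nonneg fun c _ => abs_nonneg _
  -- the two entry estimates
  have hα : ‖(W : Matrix (Fin 2) (Fin 2) ℂ) 0 0 - 1‖ ≤ (1 - ((W : Matrix (Fin 2) (Fin 2) ℂ) 0 0).re) + |imVec W 0| := by
    refine (Complex.norm_le_abs_re_add_abs_im _).trans ?_
    simp only [Complex.sub_re, Complex.one_re, Complex.sub_im, Complex.one_im, sub_zero, imVec, Matrix.cons_val_zero]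
    have h1 : ((W : Matrix (Fin 2) (Fin 2) ℂ) 0 0).re ≤ 1 := (abs_le.mp (abs_re_apply_zero_zero_le_one W)).2
    rw [abs_of_nonpos (by linarith)]
    linarith
  have hβ : ‖(W : Matrix (Fin 2) (Fin 2) ℂ) 1 0‖ ≤ |imVec W 1| + |imVec W 2| := by
    refine (Complex.norm_le_abs_re_add_abs_im _).trans ?_
    simp [imVec]
  have hsum : ∑ c : Fin 3, |imVec W c| = |imVec W 0| + |imVec W 1| + |imVec W 2| := by
    rw [Fin.sum_univ_three]
  refine linfty_opNorm_le_of_rows (by positivity) fun i => ?_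
  fin_cases i
  · -- row 0: `(α − 1, −conj β)`
    simp only [Fin.zero_eta, Matrix.sub_apply, Matrix.one_apply_eq, Matrix.one_apply_ne (show (0 : Fin 2) ≠ 1 by decide), sub_zero]
    rw [h01, norm_neg, Complex.norm_conj]
    linarith
  · -- row 1: `(β, conj α − 1)`
    simp only [Fin.mk_one, Matrix.sub_apply, Matrix.one_apply_eq, Matrix.one_apply_ne (show (1 : Fin 2) ≠ 0 by decide), sub_zero]
    rw [h11, show (starRingEnd ℂ) ((W : Matrix (Fin 2) (Fin 2) ℂ) 0 0) - 1 =
        (starRingEnd ℂ) ((W : Matrix (Fin 2) (Fin 2) ℂ) 0 0 - 1) by rw [map_sub, map_one], Complex.norm_conj]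
    linarith

/-- **`‖Wᴴ − 1‖ ≤ 2·Σ_c |imVec W c|`** on the hemisphere `Re W₀₀ ≥ 0`. -/
theorem norm_star_coe_sub_one_le (W : SU2) (hs : 0 ≤ ((W : Matrix (Fin 2) (Fin 2) ℂ) 0 0).re) :
    ‖star (W : Matrix (Fin 2) (Fin 2) ℂ) - 1‖ ≤ 2 * ∑ c : Fin 3, |imVec W c| := by
  have h11 := Literature.MathematicalPhysics.QuantumLattice.su2_apply_11 W
  have h01 := apply_zero_one_eq_neg_conj W
  have hd := one_sub_re_le_sum_abs_imVec W hs
  have hn : 0 ≤ ∑ c : Fin 3, |imVec W c| := Finset.sum_nonneg fun c _ => abs_nonneg _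
  have hα : ‖(W : Matrix (Fin 2) (Fin 2) ℂ) 0 0 - 1‖ ≤ (1 - ((W : Matrix (Fin 2) (Fin 2) ℂ) 0 0).re) + |imVec W 0| := by
    refine (Complex.norm_le_abs_re_add_abs_im _).trans ?_
    simp only [Complex.sub_re, Complex.one_re, Complex.sub_im, Complex.one_im, sub_zero, imVec, Matrix.cons_val_zero]
    have h1 : ((W : Matrix (Fin 2) (Fin 2) ℂ) 0 0).re ≤ 1 := (abs_le.mp (abs_re_apply_zero_zero_le_one W)).2
    rw [abs_of_nonpos (by linarith)]
    linarith
  have hβ : ‖(W : Matrix (Fin 2) (Fin 2) ℂ) 1 0‖ ≤ |imVec W 1| + |imVec W 2| := by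
    refine (Complex.norm_le_abs_re_add_abs_im _).trans ?_
    simp [imVec]
  have hsum : ∑ c : Fin 3, |imVec W c| = |imVec W 0| + |imVec W 1| + |imVec W 2| := by
    rw [Fin.sum_univ_three]
  refine linfty_opNorm_le_of_rows (by positivity) fun i => ?_
  fin_cases i
  · -- row 0 of `Wᴴ − 1`: `(conj α − 1, conj β)`
    simp only [Fin.zero_eta, Matrix.sub_apply, Matrix.star_apply, Matrix.one_apply_eq,
      Matrix.one_apply_ne (show (0 : Fin 2) ≠ 1 by decide), sub_zero, Complex.star_def]
    rw [show (starRingEnd ℂ) ((W : Matrix (Fin 2) (Fin 2) ℂ) 0 0) - 1 =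
        (starRingEnd ℂ) ((W : Matrix (Fin 2) (Fin 2) ℂ) 0 0 - 1) by rw [map_sub, map_one], Complex.norm_conj, Complex.norm_conj]
    linarith
  · -- row 1: `(−β, α − 1)` (as `conj (W 0 1) = −β`, `conj (W 1 1) = α`)
    simp only [Fin.mk_one, Matrix.sub_apply, Matrix.star_apply, Matrix.one_apply_eq,
      Matrix.one_apply_ne (show (1 : Fin 2) ≠ 0 by decide), sub_zero, Complex.star_def]
    rw [h01, h11, map_neg, Complex.conj_conj, Complex.conj_conj, norm_neg]
    linarith

/-! ## The second-order remainder of a product of four -/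

/-- Exact second-order Taylor remainder of a product of four elements of a ring around `1`. -/
theorem prod_four_sub_one_sub_sum_eq {R : Type*} [Ring R] (Y₀ Y₁ Y₂ Y₃ : R) :
    (1 + Y₀) * (1 + Y₁) * (1 + Y₂) * (1 + Y₃) - 1 - (Y₀ + Y₁ + Y₂ + Y₃) =
      (Y₀ * Y₁ * (1 + Y₂) + Y₀ * Y₂ + Y₁ * Y₂) * (1 + Y₃) + (Y₀ + Y₁ + Y₂) * Y₃ := by
  noncomm_ring

/-- Norm of the second-order remainder: with `t_k = ‖Y_k‖ ≤ 6`,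
`‖(1+Y₀)(1+Y₁)(1+Y₂)(1+Y₃) − 1 − ΣY_k‖ ≤ 7·(7·t₀t₁ + t₀t₂ + t₁t₂) + (t₀ + t₁ + t₂)·t₃`. -/
theorem norm_prod_four_sub_one_sub_sum_le (Y₀ Y₁ Y₂ Y₃ : Matrix (Fin 2) (Fin 2) ℂ)
    (h₂ : ‖Y₂‖ ≤ 6) (h₃ : ‖Y₃‖ ≤ 6) :
    ‖(1 + Y₀) * (1 + Y₁) * (1 + Y₂) * (1 + Y₃) - 1 - (Y₀ + Y₁ + Y₂ + Y₃)‖ ≤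
      7 * (7 * (‖Y₀‖ * ‖Y₁‖) + ‖Y₀‖ * ‖Y₂‖ + ‖Y₁‖ * ‖Y₂‖) + (‖Y₀‖ + ‖Y₁‖ + ‖Y₂‖) * ‖Y₃‖ := by
  rw [prod_four_sub_one_sub_sum_eq]
  have hX2 : ‖(1 : Matrix (Fin 2) (Fin 2) ℂ) + Y₂‖ ≤ 7 := (norm_add_le _ _).trans (by rw [norm_one]; linarith)
  have hX3 : ‖(1 : Matrix (Fin 2) (Fin 2) ℂ) + Y₃‖ ≤ 7 := (norm_add_le _ _).trans (by rw [norm_one]; linarith)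
  have t0 := norm_nonneg Y₀
  have t1 := norm_nonneg Y₁
  have t2 := norm_nonneg Y₂
  have t3 := norm_nonneg Y₃
  have hA : ‖Y₀ * Y₁ * (1 + Y₂) + Y₀ * Y₂ + Y₁ * Y₂‖ ≤ 7 * (‖Y₀‖ * ‖Y₁‖) + ‖Y₀‖ * ‖Y₂‖ + ‖Y₁‖ * ‖Y₂‖ := by
    refine (norm_add_le _ _).trans (add_le_add ((norm_add_le _ _).trans (add_le_add ?_ (norm_mul_le _ _))) (norm_mul_le _ _))
    calc ‖Y₀ * Y₁ * (1 + Y₂)‖ ≤ ‖Y₀‖ * ‖Y₁‖ * ‖1 + Y₂‖ :=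
          (norm_mul_le _ _).trans (mul_le_mul_of_nonneg_right (norm_mul_le _ _) (norm_nonneg _))
      _ ≤ ‖Y₀‖ * ‖Y₁‖ * 7 := mul_le_mul_of_nonneg_left hX2 (mul_nonneg t0 t1)
      _ = 7 * (‖Y₀‖ * ‖Y₁‖) := by ring
  have hA0 : 0 ≤ 7 * (‖Y₀‖ * ‖Y₁‖) + ‖Y₀‖ * ‖Y₂‖ + ‖Y₁‖ * ‖Y₂‖ := by positivity
  have hB : ‖(Y₀ + Y₁ + Y₂) * Y₃‖ ≤ (‖Y₀‖ + ‖Y₁‖ + ‖Y₂‖) * ‖Y₃‖ :=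
    (norm_mul_le _ _).trans (mul_le_mul_of_nonneg_right
      ((norm_add_le _ _).trans (add_le_add ((norm_add_le _ _)) le_rfl)) t3)
  refine (norm_add_le _ _).trans (add_le_add ?_ hB)
  calc ‖(Y₀ * Y₁ * (1 + Y₂) + Y₀ * Y₂ + Y₁ * Y₂) * (1 + Y₃)‖
      ≤ ‖Y₀ * Y₁ * (1 + Y₂) + Y₀ * Y₂ + Y₁ * Y₂‖ * ‖1 + Y₃‖ := norm_mul_le _ _
    _ ≤ (7 * (‖Y₀‖ * ‖Y₁‖) + ‖Y₀‖ * ‖Y₂‖ + ‖Y₁‖ * ‖Y₂‖) * 7 :=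
        mul_le_mul hA hX3 (norm_nonneg _) hA0
    _ = 7 * (7 * (‖Y₀‖ * ‖Y₁‖) + ‖Y₀‖ * ‖Y₂‖ + ‖Y₁‖ * ‖Y₂‖) := by ring

/-! ## T3 -/

/-- **T3 `QuaternionBCH` proved** (`C₁ = 588`). -/
theorem quaternionBCH : QuaternionBCH := by
  refine ⟨588, fun W hW M hM c => ?_⟩
  -- notation: the four matrices and their su(2) sizes
  have hs : ∀ k, 0 ≤ ((W k : Matrix (Fin 2) (Fin 2) ℂ) 0 0).re := fun k => le_trans (by norm_num) (hW k)
  set n : Fin 4 → ℝ := fun k => ∑ c' : Fin 3, |imVec (W k) c'| with hn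
  have hn0 : ∀ k, 0 ≤ n k := fun k => Finset.sum_nonneg fun c _ => abs_nonneg _
  have hM0 : 0 ≤ M := (abs_nonneg _).trans (hM 0 0)
  have hnM : ∀ k, n k ≤ 3 * M := fun k => by
    simp only [hn, Fin.sum_univ_three]
    linarith [hM k 0, hM k 1, hM k 2]
  have hn3 : ∀ k, n k ≤ 3 := fun k => by
    simp only [hn, Fin.sum_univ_three]
    linarith [abs_imVec_le_one (W k) 0, abs_imVec_le_one (W k) 1, abs_imVec_le_one (W k) 2]
  set Y₀ : Matrix (Fin 2) (Fin 2) ℂ := (W 0 : Matrix (Fin 2) (Fin 2) ℂ) - 1 with hY₀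
  set Y₁ : Matrix (Fin 2) (Fin 2) ℂ := (W 1 : Matrix (Fin 2) (Fin 2) ℂ) - 1 with hY₁
  set Y₂ : Matrix (Fin 2) (Fin 2) ℂ := star (W 2 : Matrix (Fin 2) (Fin 2) ℂ) - 1 with hY₂
  set Y₃ : Matrix (Fin 2) (Fin 2) ℂ := star (W 3 : Matrix (Fin 2) (Fin 2) ℂ) - 1 with hY₃
  have ht₀ : ‖Y₀‖ ≤ 2 * n 0 := norm_coe_sub_one_le (W 0) (hs 0)
  have ht₁ : ‖Y₁‖ ≤ 2 * n 1 := norm_coe_sub_one_le (W 1) (hs 1)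
  have ht₂ : ‖Y₂‖ ≤ 2 * n 2 := norm_star_coe_sub_one_le (W 2) (hs 2)
  have ht₃ : ‖Y₃‖ ≤ 2 * n 3 := norm_star_coe_sub_one_le (W 3) (hs 3)
  -- the product as a matrix and its su(2)-coordinates
  have hP : ((W 0 * W 1 * (W 2)⁻¹ * (W 3)⁻¹ : SU2) : Matrix (Fin 2) (Fin 2) ℂ) =
      (1 + Y₀) * (1 + Y₁) * (1 + Y₂) * (1 + Y₃) := by
    simp only [hY₀, hY₁, hY₂, hY₃, add_sub_cancel]
    rfl
  have hlin : imVec (W 0 * W 1 * (W 2)⁻¹ * (W 3)⁻¹) c -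
      (imVec (W 0) c + imVec (W 1) c - imVec (W 2) c - imVec (W 3) c) =
      imVecM ((1 + Y₀) * (1 + Y₁) * (1 + Y₂) * (1 + Y₃) - 1 - (Y₀ + Y₁ + Y₂ + Y₃)) c := by
    rw [imVecM_sub, imVecM_sub, imVecM_add, imVecM_add, imVecM_add, imVecM_one, ← hP, ← imVec_eq_imVecM]
    simp only [hY₀, hY₁, hY₂, hY₃, imVecM_sub, imVecM_one, imVecM_star_coe, ← imVec_eq_imVecM, Pi.sub_apply, Pi.add_apply,
      Pi.neg_apply, Pi.zero_apply]
    ring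
  rw [hlin]
  refine (abs_imVecM_le_norm _ c).trans ?_
  have h6₂ : ‖Y₂‖ ≤ 6 := by linarith [hn3 2]
  have h6₃ : ‖Y₃‖ ≤ 6 := by linarith [hn3 3]
  refine (norm_prod_four_sub_one_sub_sum_le Y₀ Y₁ Y₂ Y₃ h6₂ h6₃).trans ?_
  -- bookkeeping: every product `‖Y_j‖‖Y_k‖ ≤ 12·M·n_k`
  have t0 := norm_nonneg Y₀
  have t1 := norm_nonneg Y₁
  have t2 := norm_nonneg Y₂
  have t3 := norm_nonneg Y₃
  have p01 : ‖Y₀‖ * ‖Y₁‖ ≤ 12 * M * n 1 := by nlinarith [hnM 0, hn0 1]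
  have p02 : ‖Y₀‖ * ‖Y₂‖ ≤ 12 * M * n 2 := by nlinarith [hnM 0, hn0 2]
  have p12 : ‖Y₁‖ * ‖Y₂‖ ≤ 12 * M * n 2 := by nlinarith [hnM 1, hn0 2]
  have p3 : (‖Y₀‖ + ‖Y₁‖ + ‖Y₂‖) * ‖Y₃‖ ≤ 36 * M * n 3 := by nlinarith [hnM 0, hnM 1, hnM 2, hn0 3]
  have hsum : ∑ k : Fin 4, ∑ c' : Fin 3, |imVec (W k) c'| = n 0 + n 1 + n 2 + n 3 := by
    simp only [hn, Fin.sum_univ_four]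
  rw [hsum]
  nlinarith [hn0 0, hn0 1, hn0 2, hn0 3]

end Summit.QuantumFields.YangMills.Theorems.AllWindowsColdBoxBoxHighLine

end
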